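import Summits.BirchSwinnertonDyer.BirchSwinnertonDyer.Theorems.ClassRecordThreeEulerHalvesAtThreeJetchevTight
import Summits.BirchSwinnertonDyer.Rank1Residual.X11b.Three.KolyvaginNonvanishing
import Literature.NumberTheory.EllipticCurves.KolyvaginShaStructureDivisibility
import HarnessLib

/-!
# Route `ErratumRoadFive` (rung K2), crux `Rest3NoWitnessBranchAtFive` (item stmt-BirchSwinnertonDyer-19703), stub
# `stub_nw_offLocus`: the refined ♯-input of the Tamagawa road is TIGHT — at a frame, «a Kolyvagin certificate of
# level `M + 1` with `M ≤ ord_p ∏ c_ℓ(E)`» (W. Zhang's `M_∞ ≤ t`) is EQUIVALENT to STEP L `IndexLowerBoundAt W p K P`,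
# modulo McCallum's structure theorem in its two one-sided forms (any odd `p`; cell `bsd-stepL`, ACCEL seat
# `bsd-stepL-nw1` g0; `--supports stmt-BirchSwinnertonDyer-19703`; Theses-FREE imports)

Companion of `ErratumRoadFiveRest3NoWitnessOffLocusKolyvaginTam.lean` (p462313), whose class-level theorems take the
hypothesis `hZt : ∃ M ≤ ord_p ∏ c_ℓ(E), Koly.CertificateAt Dt β ι p M` at the Hoffstein–Luo frames. THIS FILE shows
that `hZt` asks NO MORE than the stub: at every frame carrying a conductor-`1` datum descending to a non-torsion `P`
(rank one, no `p`-torsion, `Ш(E/K)` finite, `p^{M₀} ∥ P`), STEP L (`2·ord_p[E(K):ℤP] ≤ ord_p #Ш(E/K) + 2t`) FORCES a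
certificate of some level `M + 1 ≤ t + 1` — by McCallum's Cor. 5.6 in its UPPER form (global divisibility to depth `s`
⟹ `ord_p #Ш[p^∞] + 2s ≤ 2M₀`; tree fact `McCallum1991_padicValNat_card_sha_primary_add_le_of_globalDivisibility`,
tam3-p1's vendoring) applied at depth `t + 1` — and conversely (koly's `Koly.indexLowerBoundAt_of_certificateAt_of_mccallum`,
the LOWER ∕ certificate form). So, on the tree's objects and modulo McCallum, «refined Kolyvagin `M_∞ ≤ t` at the
frame» ⟺ «STEP L at the frame» ⟺ (multr1-p2 rigidity, (ram) pairs) «the lower half of `BSD(E,p)`» ⟺ (tightness,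
control identity) «route p2's open input»: the (NW) ∩ off-Locus supplier typed by seat nw1 is EXACTLY the worth of the
stub — the `t`-refined twin of koly's K0⋆ (`STEP L ⟺ M_∞ ≤ t`, `cells/x11b3/LINE-K.md`) and of tam3-p1's J₃-dictionary
(`globalDivisibility_three_iff_shaIndexBound_sharp`, the OTHER half `M_∞ ≥ t`). THEOREMS ONLY (no definition, no named
fact, no `sorry`); both McCallum facts are HYPOTHESES (`hMcU`, `hMcL`); nothing is asserted about any certificate;
nothing booked; no census word moves (T7).

* `kolyvaginTamCertificate_of_indexLowerBoundAt` — frame level, any odd `p`: STEP L ⟹ `∃ M ≤ t, CertificateAt Dt β ι p M`.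
* `kolyvaginTamCertificate_iff_indexLowerBoundAt` — with both McCallum forms: ⟺.

References: [McCallumLMS1991] §5 Lemma 5.1 (p. 303), Thm. 5.4 (p. 308), Cor. 5.6 (p. 310); [WZhang2014] Remark 5 ∕ Thm. 10.2
(p. 199); [Jetchev2008] Thm. 1.4, Conj. 1.3; [BurungaleEtAl2026] = arXiv:2312.09301 Thm. 2 (shape `M_∞ = Σ ord_p c_ℓ`; nothing used).
-/

-- the Theorems namespace of this sub repeats the summit name by design (D-0017 nested layout)
set_option linter.dupNamespace false

noncomputable section

open scoped Classical

namespace Summit.BirchSwinnertonDyer.BirchSwinnertonDyer.Theorems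

open WeierstrassCurve Literature.NumberTheory.EllipticCurves
  Literature.NumberTheory.EllipticCurves.ModularForms
  Literature.NumberTheory.EllipticCurves.Rank1Residual
  Summit.BirchSwinnertonDyer.Rank1Residual Summit.BirchSwinnertonDyer.Rank1Residual.X11b
  Summit.BirchSwinnertonDyer.Rank1Residual.X11b.Three.Koly

/-- **STEP L at a frame FORCES a refined Kolyvagin certificate** (any odd `p`; McCallum's Cor. 5.6, upper form).
For `W/ℚ` globally minimal without CM, `K` imaginary quadratic Heegner for `N_E` with `d_K ∉ {−3, −4}`, `p` odd with
`ρ̄_{E,p^m}` onto for all `m`, a frame `(Dt, β, ι)` with conductor-`1` datum `d₁` and `P ∈ E(K)` under `P_1 = y_K`, `P`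
of infinite order, `E(K)` of rank one without `p`-torsion, `Ш(E/K)` finite, `p^{M₀} ∥ P` in `E(K)`: IF STEP L
`IndexLowerBoundAt W p K P` (`2·ord_p[E(K):ℤP] ≤ ord_p #Ш(E/K) + 2t`, `t = ord_p ∏ c_ℓ(E)`) holds THEN some derived
point `P_n`, `n ∈ S_r(M+1)` with `M ≤ t`, is NOT `p^{M+1}`-divisible in `E(K[n])` (`∃ M ≤ t, Koly.CertificateAt Dt β ι p M`;
`M_∞ ≤ t` in finite form). Proof: otherwise no certificate of level `≤ t + 1` exists, i.e. global divisibility holds to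
depth `t + 1` (`Koly.globalDivisibility_iff_forall_not_certificateAt`, definitions only), and the upper form `hMcU`
gives `ord_p #Ш[p^∞] + 2(t+1) ≤ 2M₀ = 2·ord_p[E(K):ℤP]` (`ord_p[E(K):ℤP] = M₀`: rank one, no `p`-torsion), contradicting
STEP L. CONDITIONAL on `hMcU`; nothing booked. [cite: McCallumLMS1991, §5 Cor. 5.6 (p. 310), Thm. 5.4 (p. 308), Lemma 5.1 (p. 303)]
[cite: WZhang2014, Remark 5 (p. 199) — the rank-one dictionary M_∞ ⟷ p-part of BSD over K] -/
theorem kolyvaginTamCertificate_of_indexLowerBoundAt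
    (hMcU : McCallum1991_padicValNat_card_sha_primary_add_le_of_globalDivisibility)
    (W : WeierstrassCurve ℚ) [W.IsElliptic] [W.IsGloballyMinimal] [NeZero (W.conductorNorm ℤ)]
    (hCM : ¬ W.HasCM) (K : Type) [Field K] [NumberField K] (hK : IsImaginaryQuadratic K)
    (h3 : NumberField.discr K ≠ -3) (h4 : NumberField.discr K ≠ -4)
    (hH : SatisfiesHeegnerHypothesis (W.conductorNorm ℤ) K)
    (p : ℕ) [Fact p.Prime] (hp : p ≠ 2) (hsurj : ∀ n : ℕ, W.HasSurjectiveModNGaloisRep (p ^ n : ℕ))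
    (Dt : ModularParametrizationData W (W.conductorNorm ℤ)) (β : ℤ) (ι : K →+* ℂ)
    (d₁ : KolyvaginHeegnerData Dt β ι 1) (P : (W.baseChange K).toAffine.Point)
    (hP : d₁.toGeomPoints d₁.derivedPoint = toGeomPoints (W.baseChange K) P)
    (hPinf : ¬ IsOfFinAddOrder P)
    (hrank : (W.baseChange K).mordellWeilRank = 1)
    (hiv : ∀ x : (W.baseChange K).toAffine.Point, p • x = 0 → x = 0)
    [Finite (W.baseChange K).sha] {M₀ : ℕ}
    (hdiv : ∃ Q : (W.baseChange K).toAffine.Point, ((p ^ M₀ : ℕ) : ℤ) • Q = P)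
    (hndiv : ¬ ∃ Q : (W.baseChange K).toAffine.Point, ((p ^ (M₀ + 1) : ℕ) : ℤ) • Q = P)
    (hL : IndexLowerBoundAt W p K P) :
    ∃ M : ℕ, M ≤ padicValNat p W.tamagawaProduct ∧ CertificateAt Dt β ι p M := by
  by_contra hno
  push Not at hno
  -- no certificate of level ≤ t + 1: global divisibility to depth t + 1 (definitions only)
  have hJ : ∀ (s : ℕ), s ≤ padicValNat p W.tamagawaProduct + 1 →
      ∀ (n : ℕ) (d : KolyvaginHeegnerData Dt β ι n), Squarefree n →
      (∀ ℓ ∈ n.primeFactors, Zhang2014.IsKolyvaginPrime (W.conductorNorm ℤ) W K p ℓ ∧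
        s ≤ Zhang2014.kolyvaginIndex W p ℓ) → PDiv d p s :=
    (globalDivisibility_iff_forall_not_certificateAt Dt β ι p (padicValNat p W.tamagawaProduct + 1)).mpr
      (fun M hM ↦ hno M (Nat.lt_succ_iff.mp hM))
  -- McCallum's upper form at depth t + 1: ord_p #Ш[p^∞] + 2(t+1) ≤ 2M₀
  have hU : padicValNat p (Nat.card (AddCommGroup.primaryComponent (W.baseChange K).sha p)) +
      2 * (padicValNat p W.tamagawaProduct + 1) ≤ 2 * M₀ :=
    hMcU W hCM K hK h3 h4 hH p hp hsurj Dt β ι d₁ P hP hPinf M₀ hdiv hndiv _ hJ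
  -- STEP L in McCallum's currency: ord_p[E(K):ℤP] = M₀, ord_p #Ш = ord_p #Ш[p^∞]
  have hsha : padicValNat p (W.baseChange K).shaOrder =
      padicValNat p (Nat.card (AddCommGroup.primaryComponent (W.baseChange K).sha p)) :=
    padicValNat_shaOrder_eq (W.baseChange K) p
  haveI : Finite (AddCommGroup.torsion (W.baseChange K).toAffine.Point) :=
    WeierstrassCurve.finite_torsion_point (W := W.baseChange K)
  obtain ⟨c, Q, hcQ, hcker⟩ := RankOne.exists_coord_of_mordellWeilRank_eq_one (W.baseChange K) hrank
  have hidx : padicValNat p (AddSubgroup.zmultiples P).index = M₀ :=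
    padicValNat_index_zmultiples_eq_of_divisibility c Q hcQ hcker hiv P hdiv hndiv
  unfold IndexLowerBoundAt at hL
  rw [hidx, hsha] at hL
  omega

/-- **At a frame, the refined ♯-input ⟺ STEP L, modulo McCallum's structure theorem (both one-sided forms).**
`(∃ M ≤ ord_p ∏ c_ℓ(E), Koly.CertificateAt Dt β ι p M) ↔ IndexLowerBoundAt W p K P` on the frame data of
`kolyvaginTamCertificate_of_indexLowerBoundAt`: (⇒) koly's K0⋆ kernel `Koly.indexLowerBoundAt_of_certificateAt_of_mccallum`
(certificate form `hMcL`); (⇐) the previous theorem (upper form `hMcU`). Hence seat nw1's hypothesis `hZt` of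
`stub_nw_offLocus_of_kolyvaginTamFramesHL_of_thm331Mult` is, frame by frame, exactly as strong as the STEP L it delivers
— the (NW) ∩ off-Locus stub and W. Zhang's refined non-vanishing at its Hoffstein–Luo frames are ONE statement in two
currencies. CONDITIONAL on `hMcU`, `hMcL`; nothing booked. [cite: McCallumLMS1991, §5 Cor. 5.6 (p. 310)]
[cite: WZhang2014, Remark 5 and Thm. 10.2 (p. 199)] [cite: Jetchev2008, Thm. 1.4 and Conj. 1.3 (p. 3; nothing used)] -/
theorem kolyvaginTamCertificate_iff_indexLowerBoundAt
    (hMcU : McCallum1991_padicValNat_card_sha_primary_add_le_of_globalDivisibility)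
    (hMcL : McCallum1991_pow_dvd_card_sha_primary_of_certificate)
    (W : WeierstrassCurve ℚ) [W.IsElliptic] [W.IsGloballyMinimal] [NeZero (W.conductorNorm ℤ)]
    (hCM : ¬ W.HasCM) (K : Type) [Field K] [NumberField K] (hK : IsImaginaryQuadratic K)
    (h3 : NumberField.discr K ≠ -3) (h4 : NumberField.discr K ≠ -4)
    (hH : SatisfiesHeegnerHypothesis (W.conductorNorm ℤ) K)
    (p : ℕ) [Fact p.Prime] (hp : p ≠ 2) (hsurj : ∀ n : ℕ, W.HasSurjectiveModNGaloisRep (p ^ n : ℕ))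
    (Dt : ModularParametrizationData W (W.conductorNorm ℤ)) (β : ℤ) (ι : K →+* ℂ)
    (d₁ : KolyvaginHeegnerData Dt β ι 1) (P : (W.baseChange K).toAffine.Point)
    (hP : d₁.toGeomPoints d₁.derivedPoint = toGeomPoints (W.baseChange K) P)
    (hPinf : ¬ IsOfFinAddOrder P)
    (hrank : (W.baseChange K).mordellWeilRank = 1)
    (hiv : ∀ x : (W.baseChange K).toAffine.Point, p • x = 0 → x = 0)
    [Finite (W.baseChange K).sha] {M₀ : ℕ}
    (hdiv : ∃ Q : (W.baseChange K).toAffine.Point, ((p ^ M₀ : ℕ) : ℤ) • Q = P)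
    (hndiv : ¬ ∃ Q : (W.baseChange K).toAffine.Point, ((p ^ (M₀ + 1) : ℕ) : ℤ) • Q = P) :
    (∃ M : ℕ, M ≤ padicValNat p W.tamagawaProduct ∧ CertificateAt Dt β ι p M) ↔
      IndexLowerBoundAt W p K P :=
  ⟨fun ⟨_, hMt, hcert⟩ ↦ indexLowerBoundAt_of_certificateAt_of_mccallum W K hMcL hCM hK h3 h4 hH p hp hsurj Dt β ι
      d₁ P hP hPinf hrank hiv hdiv hndiv hcert hMt,
    kolyvaginTamCertificate_of_indexLowerBoundAt hMcU W hCM K hK h3 h4 hH p hp hsurj Dt β ι d₁ P hP hPinf hrank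
      hiv hdiv hndiv⟩

end Summit.BirchSwinnertonDyer.BirchSwinnertonDyer.Theorems

end
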